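import Summits.QuantumFields.YangMills.Theorems.BalabanUVNodesN09FibreThresholdNullOfAnalyticChart
import Literature.MathematicalPhysics.QuantumFieldTheory.Balaban1983to89.BlockAveragingSU2
import HarnessLib

/-!
# Crux `FluctuationComparisonRegPrIntL` (stmt-QuantumFields-20520, rung R3) — «THE EXACT-THRESHOLD SET OF A FINE VARIABLE ALONG A REAL-ANALYTIC FIBRE CHART IS NULL»,
# organ ∕ S1a edition of pub-ymgap's ✓`BalabanUVNodesN09FibreThresholdNullOfAnalyticChart` §2 with the BASE-POINT HYPOTHESIS WEAKENED from `W z₀ = 1` to `‖W z₀ − 1‖ < r`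
# (one point strictly INSIDE the threshold window), plus the `dist1`∕`SU(2)` spelling (DEFINITION-FREE; px20 g21 LOCATE 11:05Z, LEAD w3 g27 №8 (B) «WELCOME — px13∕px17's call»;
# filed by px20 g22 on LEAD w3 g27 №38 (4) «GO as a FREE D0∕(c)-lane helper — serves TN-CUT-KINK-2's residual»)

Cell `ym3-torus` (YM ladder rung R3 = continuum `SU(2)` Yang–Mills on the three-torus — a RUNG: NOT d = 4, NOT infinite volume, NOT a mass gap, NOT Clay).
Width seat `ym3-torus-px20` (draft gen 21, filed gen 22); `--kind proof --supports stmt-QuantumFields-20520 --as helper`, count-neutral, no registry ∕ binder ∕ `Lines/` edit, default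
heartbeats, `autoImplicit false`.  Over ✓`Literature.Analysis.Calculus.addHaar_zeroSet_eq_zero_of_analyticOnNhd_complex` ([Mityagin2015] Prop. 1, kernel-proved in the tree),
lit ✓`HaarEigenvalueSphereNull.exists_mem_spectrum_norm_sub_one_eq`, ✓N09's public matrix one-liners (`det_algebraMap_sub_eq_zero_iff'`, `analyticOnNhd_det'`,
`finite_setOf_norm_eq_one_and_norm_sub_one_eq'`), Mathlib `spectrum.norm_le_norm_of_mem` ∕ `spectrum.sub_singleton_eq`, lit ✓`SU2Mean.dist1_eq_norm` (`rfl`).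

WHY.  Two census rows of the cell ask for «analytic + non-constant ⟹ null level set» on a fibre: (A4, branch 1) the KINK TRANSVERSALITY of the organ's (Diff₀) conjunct — the
`z`-set where a fine plaquette of `Φ(X s, z)` sits EXACTLY at a ramp kink `dist1 = 24∕25·θ_n` or `θ_n∕2` of `mwCut` must be `τ`-null (LEAD w3 g27 №1 (3) A4 ∕ №3 (C)); and §67.3 (c) ∕
px13 g24's (T⊥)♭ — continuity of the full∕cut densities needs the guard-level sets `{dist1 (loopHol …) = δ_SU}` to be fibre-null.  pub-ymgap's N09 file proves exactly this
mechanism for the T⁴ programme, but with the base point `W z₀ = 1` (the flat holonomy), which a fibre over a non-flat window datum need not contain; what such a fibre DOES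
contain is a point whose variable is strictly inside the window (`‖W z₀ − 1‖ < r`).  For a UNITARY `W z₀` that is enough: every eigenvalue `λ` of `W z₀` has
`|λ − 1| ≤ ‖W z₀ − 1‖ < r` (spectral radius ≤ norm), so `det(λ·1 − W z₀) ≠ 0` for the (≤ 2) unit `λ` at distance `r` from `1`, and N09's proof runs verbatim.
* `norm_sub_one_le_of_mem_spectrum` — `λ ∈ σ(M) ⟹ ‖λ − 1‖ ≤ ‖M − 1‖` (any square complex matrix, operator norm);
* ★★`addHaar_setOf_norm_sub_one_eq_eq_zero_of_analyticOnNhd_of_lt` — `E` finite-dimensional real, `η` add-Haar, `O ⊆ E` open connected, `W : E → M_N(ℂ)` real-analytic on `O`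
  with unitary values on `O`, `z₀ ∈ O` with `‖W z₀ − 1‖ < r` ⟹ `η {z ∈ O | ‖W z − 1‖ = r} = 0`;
* ★`measure_setOf_norm_sub_one_eq_eq_zero_of_absolutelyContinuous_of_lt` — the same for any `τ ≪ η` with `τ Oᶜ = 0` (no `∈ O` clause);
* ★★`measure_setOf_dist1_eq_eq_zero_of_analyticChart` — the `SU(2)`∕`dist1` spelling the organ∕S1a texts use: `W : E → SU(2)` with `z ↦ (W z : M₂(ℂ))` real-analytic on `O`,
  `dist1 (W z₀) < r` at some `z₀ ∈ O` ⟹ `τ {z | dist1 (W z) = r} = 0`.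
A kink-transversality or (c)-continuity DISCHARGER supplies: the fibre law `τ ≪` add-Haar on a finite-dimensional fibre space, a connected open carrier `O`, real-analyticity in
`z` of the relevant holonomy of the chart (D0 ∕ (C-an) — NOT provided here), and one fibre point strictly inside the threshold.

HONEST FRAMING: kernel linear algebra ∕ measure theory BY NAME over a DISPLAYED chart; nothing of Bałaban's analysis is asserted or proved; the chart's analyticity is a HYPOTHESIS;
A4, (c), (T⊥), S1aᴴ, `SpreadFibreLawH(J)(sq)` ∕ `OrganDischargeInputsHJ(sq)` (UNDISCHARGED), the five registered stubs of `Lines/semiclassical_s2beta.lean` (3732b7df untouched), crux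
20520 and `YM3TorusSU2` are NOT proved; rung R3 = SU(2) YM₃ on T³ at fixed lattice data — NOT d = 4, NOT infinite volume, NOT a mass gap, NOT Clay; the Yang–Mills mass gap is NOT
proved.  [folklore]
-/

set_option autoImplicit false

noncomputable section

open MeasureTheory Set Filter Topology
open scoped ENNReal Matrix.Norms.L2Operator Pointwise
open Literature.MathematicalPhysics.QuantumFieldTheory.Balaban1983to89
open Literature.MathematicalPhysics.QuantumFieldTheory.Balaban1983to89.HaarEigenvalueSphereNull (exists_mem_spectrum_norm_sub_one_eq)
open Literature.Analysis.Calculus (addHaar_zeroSet_eq_zero_of_analyticOnNhd_complex)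
open Summit.QuantumFields.YangMills.BalabanUVNodes.N09FibreThresholdNullOfAnalyticChart
  (det_algebraMap_sub_eq_zero_iff' analyticOnNhd_det' finite_setOf_norm_eq_one_and_norm_sub_one_eq')

namespace Summit.QuantumFields.YangMills.Theorems.OrganTangentThresholdNullOfAnalyticChart

/-! ## §1 Spectral radius ≤ norm, shifted to `1` -/

/-- `λ ∈ σ(M) ⟹ ‖λ − 1‖ ≤ ‖M − 1‖` (operator norm; `σ(M) − {1} = σ(M − 1)` and Mathlib's `spectrum.norm_le_norm_of_mem`). [folklore] -/
theorem norm_sub_one_le_of_mem_spectrum {n : Type*} [Fintype n] [DecidableEq n] [Nonempty n] (M : Matrix n n ℂ) {l : ℂ}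
    (hl : l ∈ spectrum ℂ M) : ‖l - 1‖ ≤ ‖M - 1‖ := by
  have h1 : l - 1 ∈ spectrum ℂ (M - 1) := by
    have hm : l - 1 ∈ spectrum ℂ M - ({1} : Set ℂ) := Set.sub_mem_sub hl (Set.mem_singleton 1)
    rw [spectrum.sub_singleton_eq M (1 : ℂ), map_one] at hm
    exact hm
  exact spectrum.norm_le_norm_of_mem h1

/-! ## §2 The `r`-sphere of a unitary-valued real-analytic matrix function is null — base point strictly inside -/

section Generic

variable {n : Type*} [Fintype n] [DecidableEq n] [Nonempty n]
  {E : Type*} [NormedAddCommGroup E] [NormedSpace ℝ E] [FiniteDimensional ℝ E] [MeasurableSpace E] [BorelSpace E]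
  (η : Measure E) [η.IsAddHaarMeasure]

/-- ★★ **THE `r`-SPHERE IS NULL, BASE POINT STRICTLY INSIDE.**  `O ⊆ E` open connected, `W : E → M_N(ℂ)` real-analytic on `O` with unitary values on `O`, `z₀ ∈ O` with
`‖W z₀ − 1‖ < r` ⟹ `η {z ∈ O | ‖W z − 1‖ = r} = 0` (✓N09 §2's proof with the non-vanishing witness `det(λ·1 − W z₀) ≠ 0` now from §1: an eigenvalue of `W z₀` on the
`r`-sphere would force `r ≤ ‖W z₀ − 1‖`). [folklore] -/
theorem addHaar_setOf_norm_sub_one_eq_eq_zero_of_analyticOnNhd_of_lt {O : Set E} (hO : IsOpen O) (hOc : IsConnected O) {W : E → Matrix n n ℂ}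
    (hW : AnalyticOnNhd ℝ W O) (hWu : ∀ z ∈ O, W z ∈ Matrix.unitaryGroup n ℂ) {z₀ : E} (hz₀ : z₀ ∈ O) {r : ℝ} (hW₀ : ‖W z₀ - 1‖ < r) :
    η {z ∈ O | ‖W z - 1‖ = r} = 0 := by
  set Λ : Set ℂ := {l : ℂ | ‖l‖ = 1 ∧ ‖l - 1‖ = r} with hΛ
  have hΛf : Λ.Finite := finite_setOf_norm_eq_one_and_norm_sub_one_eq' r
  -- each eigenvalue hypersurface is null
  have hnull : ∀ l ∈ Λ, η {z ∈ O | (algebraMap ℂ (Matrix n n ℂ) l - W z).det = 0} = 0 := by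
    intro l hl
    have han : AnalyticOnNhd ℝ (fun z => (algebraMap ℂ (Matrix n n ℂ) l - W z).det) O := by
      intro z hz
      have h1 : AnalyticAt ℝ (fun z => algebraMap ℂ (Matrix n n ℂ) l - W z) z := analyticAt_const.sub (hW z hz)
      exact ((analyticOnNhd_det' _ (Set.mem_univ _)).restrictScalars.comp h1)
    refine addHaar_zeroSet_eq_zero_of_analyticOnNhd_complex η hO hOc han ⟨z₀, hz₀, ?_⟩
    intro hdet
    have hlσ : l ∈ spectrum ℂ (W z₀) := (det_algebraMap_sub_eq_zero_iff' l (W z₀)).1 hdet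
    have hle : ‖l - 1‖ ≤ ‖W z₀ - 1‖ := norm_sub_one_le_of_mem_spectrum (W z₀) hlσ
    rw [hl.2] at hle
    exact absurd hW₀ (not_lt.2 hle)
  -- the sphere lies in the finite union
  have hsub : {z ∈ O | ‖W z - 1‖ = r} ⊆ ⋃ l ∈ Λ, {z ∈ O | (algebraMap ℂ (Matrix n n ℂ) l - W z).det = 0} := by
    rintro z ⟨hz, hzr⟩
    obtain ⟨l, hlσ, hl1, hlr⟩ := exists_mem_spectrum_norm_sub_one_eq (⟨W z, hWu z hz⟩ : Matrix.unitaryGroup n ℂ)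
    refine Set.mem_iUnion₂.2 ⟨l, ⟨hl1, by rw [hlr]; exact hzr⟩, hz, ?_⟩
    exact (det_algebraMap_sub_eq_zero_iff' l (W z)).2 hlσ
  exact measure_mono_null hsub ((measure_biUnion_null_iff hΛf.countable).2 hnull)

/-- ★ The same for any measure `τ ≪ η` carried by `O`: `τ {z | ‖W z − 1‖ = r} = 0`. [folklore] -/
theorem measure_setOf_norm_sub_one_eq_eq_zero_of_absolutelyContinuous_of_lt {τ : Measure E} (hτ : τ ≪ η) {O : Set E} (hO : IsOpen O) (hOc : IsConnected O)
    (hτO : τ Oᶜ = 0) {W : E → Matrix n n ℂ} (hW : AnalyticOnNhd ℝ W O) (hWu : ∀ z ∈ O, W z ∈ Matrix.unitaryGroup n ℂ) {z₀ : E} (hz₀ : z₀ ∈ O)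
    {r : ℝ} (hW₀ : ‖W z₀ - 1‖ < r) :
    τ {z | ‖W z - 1‖ = r} = 0 := by
  have h1 : τ {z ∈ O | ‖W z - 1‖ = r} = 0 := hτ (addHaar_setOf_norm_sub_one_eq_eq_zero_of_analyticOnNhd_of_lt η hO hOc hW hWu hz₀ hW₀)
  have hsub : {z | ‖W z - 1‖ = r} ⊆ {z ∈ O | ‖W z - 1‖ = r} ∪ Oᶜ := by
    intro z hz
    by_cases hzO : z ∈ O
    · exact Or.inl ⟨hzO, hz⟩
    · exact Or.inr hzO
  exact measure_mono_null hsub (measure_union_null h1 hτO)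

/-! ## §3 The `SU(2)` ∕ `dist1` spelling -/

/-- ★★ **EXACT-THRESHOLD SETS OF AN `SU(2)`-VALUED REAL-ANALYTIC CHART ARE NULL.**  `τ ≪ η` carried by the open connected `O`, `W : E → SU(2)` with `z ↦ (W z : M₂(ℂ))`
real-analytic on `O`, and ONE `z₀ ∈ O` with `dist1 (W z₀) < r` ⟹ `τ {z | dist1 (W z) = r} = 0` — the letter a kink-transversality (organ A4, branch 1) or a (c)-continuity
((T⊥)♭) discharger `exact`s per plaquette ∕ member variable. [folklore] -/
theorem measure_setOf_dist1_eq_eq_zero_of_analyticChart {τ : Measure E} (hτ : τ ≪ η) {O : Set E} (hO : IsOpen O) (hOc : IsConnected O) (hτO : τ Oᶜ = 0)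
    {W : E → Matrix.specialUnitaryGroup (Fin 2) ℂ} (hW : AnalyticOnNhd ℝ (fun z => (W z : Matrix (Fin 2) (Fin 2) ℂ)) O)
    {z₀ : E} (hz₀ : z₀ ∈ O) {r : ℝ} (hW₀ : dist1 (W z₀) < r) :
    τ {z | dist1 (W z) = r} = 0 := by
  have hWu : ∀ z ∈ O, (W z : Matrix (Fin 2) (Fin 2) ℂ) ∈ Matrix.unitaryGroup (Fin 2) ℂ :=
    fun z _ => (Matrix.mem_specialUnitaryGroup_iff.1 (W z).2).1
  have h := measure_setOf_norm_sub_one_eq_eq_zero_of_absolutelyContinuous_of_lt η hτ hO hOc hτO hW hWu hz₀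
    (r := r) (by rw [← SU2Mean.dist1_eq_norm]; exact hW₀)
  have hset : {z | dist1 (W z) = r} = {z | ‖(W z : Matrix (Fin 2) (Fin 2) ℂ) - 1‖ = r} := by
    ext z; rw [Set.mem_setOf_eq, Set.mem_setOf_eq, SU2Mean.dist1_eq_norm]
  rw [hset]; exact h

end Generic

end Summit.QuantumFields.YangMills.Theorems.OrganTangentThresholdNullOfAnalyticChart

end
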